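import Mathlib
import Summits.Ventures.PercRepro2.A3BetweenCondExp

/-!
# The residual (MEANS-a₃) in Mathlib's conditional-expectation language (blind cell PercRepro2,
typer-1 g16; p5 g12's `A3Fibre.lean` / `proofs/P5-A3FIBRE.md` §2; the lead's word
2026-08-26T19:57:57Z — part II, on `A3BetweenCondExp.lean`)

With `𝒢 = σ(C(a₃))` (`clusterSigma`) and `μ_A = (percMeasureOf p hp)[|A]`, the conditional
expectations given the revealed cluster are the fibre means (`condMean_ae_eq_condExp`, part I).
Identifying the fibre masses of the (HCOV) functionals with the atoms of `A3Fibre.lean`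
(`fibreExpect_Q_sigma`, `fibreExpect_Q_F`, `fibreExpect_Q_inU`, and the `PD`-fibres as the `A`-fibres)
and expanding the covariances under the conditioned product measures into the fibre sums gives

* **`btw_eq_covariance`**: for `P(Q), P(PD) ≠ 0`,
  `btw = P(Q) · cov[μ_Q[σ_b | 𝒢], μ_Q[F | 𝒢]; μ_Q] − P(PD) · cov[μ_PD[1_{b∈U} | 𝒢], μ_PD[1_{o∈U} | 𝒢]; μ_PD]`
  (`F = σ_o + σ₃ (γ − 1_{o∈U})`, `γ = D_o / D`) — the means companion of `Gc_eq_covariance`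
  (HCovCovariance.lean): the between-cluster part of the law of total covariance;
* **`A3Between_iff_covariance`**: for `0 < P(Q), P(PD)`, **(MEANS-a₃)** `A3Between` ⟺
  `P(PD) · cov[μ_PD[1_{b∈U} | 𝒢], μ_PD[1_{o∈U} | 𝒢]; μ_PD] ≤ P(Q) · cov[μ_Q[σ_b | 𝒢], μ_Q[F | 𝒢]; μ_Q]` —
  the (HCOV)-shaped inequality (`HCov_iff_covariance`) for the conditional means given the revealed
  cluster of `a₃`.

A LANGUAGE line (an equivalence): the crux of record and the residual are unmoved.
-/

namespace Summit.Ventures.PercRepro2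

open UnionCluster MeasureTheory ProbabilityTheory MeasureBridge

namespace CovForm

namespace A3Means

/-! ## The fibre masses of the (HCOV) functionals -/

section Masses

variable {V : Type*} {E : Type*} [Fintype V] [DecidableEq V] [Fintype E] [DecidableEq E]

omit [Fintype V] [DecidableEq V] in
/-- The `Q`-fibre mass of `σ_v` is `S_{σ_v}(W)`. -/
lemma fibreExpect_Q_sigma (p : E → ℝ) (ends : E → Sym2 V) (a₁ a₂ a₃ v : V) (W : Finset V) :
    fibreExpect p ends a₃ (avoidAll ends a₂ {a₁}) (sigma ends a₁ a₂ v) W =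
      A3Fibre.Ssig p ends a₁ a₂ a₃ v W := by
  unfold fibreExpect A3Fibre.Ssig A3Fibre.fibre
  rw [← expect_ind2, ← expect_ind2]
  unfold expect
  rw [← Finset.sum_sub_distrib]
  refine Finset.sum_congr rfl fun ω _ => ?_
  simp only [sigma, iL, iH]
  ring

omit [Fintype V] [DecidableEq V] in
/-- The `Q`-fibre mass of `1_{v ∈ U}` is `S_{U_v}(W)`. -/
lemma fibreExpect_Q_inU (p : E → ℝ) (ends : E → Sym2 V) (a₁ a₂ a₃ v : V) (W : Finset V) :
    fibreExpect p ends a₃ (avoidAll ends a₂ {a₁}) (inU ends a₁ a₂ v) W =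
      A3Fibre.Su p ends a₁ a₂ a₃ v W := by
  unfold fibreExpect A3Fibre.Su A3Fibre.fibre
  rw [← expect_ind2, ← expect_ind2]
  unfold expect
  rw [← Finset.sum_add_distrib]
  refine Finset.sum_congr rfl fun ω _ => ?_
  simp only [inU, iL, iH]
  ring

omit [Fintype V] [DecidableEq V] in
/-- The `Q`-fibre mass `P(Q ∩ {C = W}) = m_W`. -/
lemma prob_Q_inter_clusterEvent (p : E → ℝ) (ends : E → Sym2 V) (a₁ a₂ a₃ : V) (W : Finset V) :
    prob p (avoidAll ends a₂ {a₁} ∩ clusterEvent ends a₃ (↑W : Set V)) =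
      A3Fibre.mW p ends a₁ a₂ a₃ W := rfl

omit [Fintype V] in
/-- The `Q`-fibre mass of `F = σ_o + σ₃ (γ − 1_{o∈U})` is `S_F(W)` (`σ₃ = s3 W` on the fibre). -/
lemma fibreExpect_Q_F (p : E → ℝ) (ends : E → Sym2 V) (o a₁ a₂ a₃ : V) (W : Finset V) :
    fibreExpect p ends a₃ (avoidAll ends a₂ {a₁})
        (Ffun ends o a₁ a₂ a₃ (gamma p ends o a₁ a₂ a₃)) W =
      A3Fibre.SF p ends o a₁ a₂ a₃ W := by
  have key : (fun ω => (A3Fibre.fibre ends a₁ a₂ a₃ W).indicator 1 ω *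
      Ffun ends o a₁ a₂ a₃ (gamma p ends o a₁ a₂ a₃) ω) =
      fun ω => (A3Fibre.fibre ends a₁ a₂ a₃ W).indicator 1 ω * sigma ends a₁ a₂ o ω +
        A3Fibre.s3 a₁ a₂ W *
          ((A3Fibre.fibre ends a₁ a₂ a₃ W).indicator 1 ω *
            (gamma p ends o a₁ a₂ a₃ * 1 - inU ends a₁ a₂ o ω)) := by
    funext ω
    by_cases hω : ω ∈ A3Fibre.fibre ends a₁ a₂ a₃ W
    · rw [Set.indicator_of_mem hω, Ffun, sigma_a3_eq_s3 hω]
      simp only [Pi.one_apply]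
      ring
    · simp [Set.indicator_of_notMem hω]
  have hmW : expect p (fun ω => (A3Fibre.fibre ends a₁ a₂ a₃ W).indicator 1 ω *
      (gamma p ends o a₁ a₂ a₃ * 1 - inU ends a₁ a₂ o ω)) =
      gamma p ends o a₁ a₂ a₃ * A3Fibre.mW p ends a₁ a₂ a₃ W - A3Fibre.Su p ends a₁ a₂ a₃ o W := by
    rw [← fibreExpect_Q_inU, ← prob_Q_inter_clusterEvent, ← expect_ind1]
    unfold fibreExpect A3Fibre.fibre expect
    rw [Finset.mul_sum, ← Finset.sum_sub_distrib]
    exact Finset.sum_congr rfl fun ω _ => by ring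
  have hσ : expect p (fun ω => (A3Fibre.fibre ends a₁ a₂ a₃ W).indicator 1 ω *
      sigma ends a₁ a₂ o ω) = A3Fibre.Ssig p ends a₁ a₂ a₃ o W := by
    rw [← fibreExpect_Q_sigma]
    rfl
  show expect p (fun ω => (A3Fibre.fibre ends a₁ a₂ a₃ W).indicator 1 ω *
      Ffun ends o a₁ a₂ a₃ (gamma p ends o a₁ a₂ a₃) ω) = _
  rw [key, expect_add_const_mul, hσ, hmW]
  rfl

omit [Fintype V] in
/-- The `PD`-fibre mass of `f`: the `Q`-fibre mass on the `A`-fibres, `0` elsewhere. -/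
lemma fibreExpect_PD_eq (p : E → ℝ) (ends : E → Sym2 V) (a₁ a₂ a₃ : V) (f : Config E → ℝ)
    (W : Finset V) :
    fibreExpect p ends a₃ (PDEvent ends a₁ a₂ a₃) f W =
      if a₁ ∉ W ∧ a₂ ∉ W then fibreExpect p ends a₃ (avoidAll ends a₂ {a₁}) f W else 0 := by
  unfold fibreExpect
  split_ifs with h
  · rw [PD_inter_clusterEvent_of_notMem h.1 h.2]
    rfl
  · rw [PD_inter_clusterEvent_eq_empty h]
    simp [expect]

omit [Fintype V] in
/-- The `PD`-fibre mass `P(PD ∩ {C = W})`: `m_W` on the `A`-fibres, `0` elsewhere. -/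
lemma prob_PD_inter_clusterEvent (p : E → ℝ) (ends : E → Sym2 V) (a₁ a₂ a₃ : V) (W : Finset V) :
    prob p (PDEvent ends a₁ a₂ a₃ ∩ clusterEvent ends a₃ (↑W : Set V)) =
      if a₁ ∉ W ∧ a₂ ∉ W then A3Fibre.mW p ends a₁ a₂ a₃ W else 0 := by
  split_ifs with h
  · rw [PD_inter_clusterEvent_of_notMem h.1 h.2]
    rfl
  · rw [PD_inter_clusterEvent_eq_empty h]
    simp [prob]

/-- The `PD`-side product sum is the `A`-fibre sum of `A3Fibre.btw`. -/
lemma sum_PD_mul (p : E → ℝ) (ends : E → Sym2 V) (o a₁ a₂ a₃ b : V) :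
    ∑ W : Finset V, fibreExpect p ends a₃ (PDEvent ends a₁ a₂ a₃) (inU ends a₁ a₂ b) W *
        fibreExpect p ends a₃ (PDEvent ends a₁ a₂ a₃) (inU ends a₁ a₂ o) W /
        prob p (PDEvent ends a₁ a₂ a₃ ∩ clusterEvent ends a₃ (↑W : Set V)) =
      ∑ W ∈ A3Fibre.fibresA a₁ a₂, A3Fibre.Su p ends a₁ a₂ a₃ b W * A3Fibre.Su p ends a₁ a₂ a₃ o W /
        A3Fibre.mW p ends a₁ a₂ a₃ W := by
  unfold A3Fibre.fibresA
  rw [Finset.sum_filter]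
  refine Finset.sum_congr rfl fun W _ => ?_
  rw [fibreExpect_PD_eq, fibreExpect_PD_eq, prob_PD_inter_clusterEvent]
  split_ifs with h
  · rw [fibreExpect_Q_inU, fibreExpect_Q_inU]
  · simp

/-- The `PD`-side linear sum is the `A`-fibre sum of `A3Fibre.btw`. -/
lemma sum_PD_inU (p : E → ℝ) (ends : E → Sym2 V) (a₁ a₂ a₃ v : V) :
    ∑ W : Finset V, fibreExpect p ends a₃ (PDEvent ends a₁ a₂ a₃) (inU ends a₁ a₂ v) W =
      ∑ W ∈ A3Fibre.fibresA a₁ a₂, A3Fibre.Su p ends a₁ a₂ a₃ v W := by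
  unfold A3Fibre.fibresA
  rw [Finset.sum_filter]
  refine Finset.sum_congr rfl fun W _ => ?_
  rw [fibreExpect_PD_eq]
  split_ifs with h
  · rw [fibreExpect_Q_inU]
  · rfl

end Masses

/-! ## The residual as a covariance of conditional means -/

section Covariance

variable {V : Type*} {E : Type*} [Fintype V] [DecidableEq V] [Fintype E] [DecidableEq E]

/-- Covariance is invariant under a.e. modification of both arguments. -/
lemma covariance_congr_ae {Ω : Type*} [MeasurableSpace Ω] {μ : Measure Ω} {X X' Y Y' : Ω → ℝ}
    (hX : X =ᵐ[μ] X') (hY : Y =ᵐ[μ] Y') : cov[X, Y; μ] = cov[X', Y'; μ] := by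
  unfold covariance
  rw [integral_congr_ae hX, integral_congr_ae hY]
  refine integral_congr_ae ((hX.and hY).mono fun ω h => ?_)
  simp only [h.1, h.2]

/-- **(MEANS-a₃) as a covariance identity**: for `P(Q), P(PD) ≠ 0`,
`btw = P(Q) · cov[μ_Q[σ_b | 𝒢], μ_Q[F | 𝒢]; μ_Q] − P(PD) · cov[μ_PD[1_{b∈U} | 𝒢], μ_PD[1_{o∈U} | 𝒢]; μ_PD]`
with `𝒢 = σ(C(a₃))` and `μ_A = (percMeasureOf p hp)[|A]` — the between-cluster part of the law of
total covariance behind `Gc_eq_covariance`. -/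
theorem btw_eq_covariance (p : E → ℝ) (hp : IsProbVec p) (ends : E → Sym2 V) (o a₁ a₂ a₃ b : V)
    (hQ : prob p (avoidAll ends a₂ {a₁}) ≠ 0) (hD : prob p (PDEvent ends a₁ a₂ a₃) ≠ 0) :
    A3Fibre.btw p ends o a₁ a₂ a₃ b =
      prob p (avoidAll ends a₂ {a₁}) *
        cov[((percMeasureOf p hp)[|avoidAll ends a₂ {a₁}])[sigma ends a₁ a₂ b | clusterSigma ends a₃],
          ((percMeasureOf p hp)[|avoidAll ends a₂ {a₁}])[Ffun ends o a₁ a₂ a₃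
            (gamma p ends o a₁ a₂ a₃) | clusterSigma ends a₃];
          (percMeasureOf p hp)[|avoidAll ends a₂ {a₁}]] -
      prob p (PDEvent ends a₁ a₂ a₃) *
        cov[((percMeasureOf p hp)[|PDEvent ends a₁ a₂ a₃])[inU ends a₁ a₂ b | clusterSigma ends a₃],
          ((percMeasureOf p hp)[|PDEvent ends a₁ a₂ a₃])[inU ends a₁ a₂ o | clusterSigma ends a₃];
          (percMeasureOf p hp)[|PDEvent ends a₁ a₂ a₃]] := by
  rw [covariance_congr_ae (condMean_ae_eq_condExp p hp ends a₃ _ _).symm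
      (condMean_ae_eq_condExp p hp ends a₃ _ _).symm,
    covariance_congr_ae (condMean_ae_eq_condExp p hp ends a₃ _ _).symm
      (condMean_ae_eq_condExp p hp ends a₃ _ _).symm,
    covariance_cond_percMeasureOf p hp hQ, covariance_cond_percMeasureOf p hp hD,
    expect_indicator_condMean_mul, expect_indicator_condMean_mul,
    expect_indicator_condMean hp, expect_indicator_condMean hp, expect_indicator_condMean hp,
    expect_indicator_condMean hp, sum_PD_mul, sum_PD_inU, sum_PD_inU]
  simp only [fibreExpect_Q_sigma, fibreExpect_Q_F, prob_Q_inter_clusterEvent]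
  unfold A3Fibre.btw
  field_simp
  ring

/-- **(MEANS-a₃) in the language of conditional covariances**: for `0 < P(Q)` and `0 < P(PD)`,
`A3Between ↔ P(PD) · cov[μ_PD[1_{b∈U} | 𝒢], μ_PD[1_{o∈U} | 𝒢]; μ_PD] ≤ P(Q) · cov[μ_Q[σ_b | 𝒢], μ_Q[F | 𝒢]; μ_Q]`
— the (HCOV) inequality `HCov_iff_covariance` for the conditional means given the revealed cluster
`C(a₃)` (`𝒢 = σ(C(a₃))`). -/
theorem A3Between_iff_covariance (p : E → ℝ) (hp : IsProbVec p) (ends : E → Sym2 V)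
    (o a₁ a₂ a₃ b : V) (hQ : 0 < prob p (avoidAll ends a₂ {a₁}))
    (hD : 0 < prob p (PDEvent ends a₁ a₂ a₃)) :
    A3Fibre.A3Between p ends o a₁ a₂ a₃ b ↔
      prob p (PDEvent ends a₁ a₂ a₃) *
          cov[((percMeasureOf p hp)[|PDEvent ends a₁ a₂ a₃])[inU ends a₁ a₂ b | clusterSigma ends a₃],
            ((percMeasureOf p hp)[|PDEvent ends a₁ a₂ a₃])[inU ends a₁ a₂ o | clusterSigma ends a₃];
            (percMeasureOf p hp)[|PDEvent ends a₁ a₂ a₃]] ≤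
        prob p (avoidAll ends a₂ {a₁}) *
          cov[((percMeasureOf p hp)[|avoidAll ends a₂ {a₁}])[sigma ends a₁ a₂ b |
              clusterSigma ends a₃],
            ((percMeasureOf p hp)[|avoidAll ends a₂ {a₁}])[Ffun ends o a₁ a₂ a₃
              (gamma p ends o a₁ a₂ a₃) | clusterSigma ends a₃];
            (percMeasureOf p hp)[|avoidAll ends a₂ {a₁}]] := by
  unfold A3Fibre.A3Between
  rw [btw_eq_covariance p hp ends o a₁ a₂ a₃ b hQ.ne' hD.ne']
  constructor
  · intro h
    linarith
  · intro h
    linarith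

end Covariance

end A3Means

end CovForm

end Summit.Ventures.PercRepro2
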